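import Mathlib
import HarnessLib

/-!
# Coarsening a grading along a map of degrees; the ideal `Q + (u - 1)` for a homogeneous unit `u`

Cell `res-hironaka`, line `L W4.3`, door crux `HypersurfaceCentreConstruction`
(stmt-ResolutionOfSingularities-19897), E2 tier; registrar `res-L1-w43-plan-1`, ORDER (o63) G-HT, SPEC (Δ7)
`GHT_sketch.lean` (3912825473c6cb9b).  Hand: `res-D-pv-031`.  General-purpose graded commutative algebra
used by `…Theorems/WeightedInvariantGradedHomogeneousHeight.lean` (the proof of G-HT); everything here is
OURS / folklore, nothing is a statement of [Hironaka2017].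

* `coarsen 𝒜 f` — **the coarsening of a grading** `𝒜 : ι → AddSubgroup A` (`GradedRing 𝒜`) along an
  additive map `f : ι →+ κ`: `A_k := ⊕_{f i = k} A_i` (the elements whose `𝒜`-components outside `f⁻¹(k)`
  vanish); `nonempty_gradedRing_coarsen` — these pieces grade the ring; `isHomogeneous_coarsen_of_isHomogeneous`,
  `isHomogeneous_coarsen_of_isHomogeneous_coarsen` — a homogeneous ideal stays homogeneous under (further)
  coarsening.
* `sub_one_not_mem` — for a proper homogeneous ideal `Q` and a homogeneous unit `u` of non-zero degree,
  `u - 1 ∉ Q`; `sup_span_sub_one_ne_top` — if moreover the degree group is commutative and the degree of `u`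
  is detected by an additive map `φ : ι →+ ℤ`, then `Q + (u - 1) ≠ A` (extreme-`φ`-value components).

[folklore; Bruns–Herzog, *Cohen–Macaulay rings* §1.5 for the graded background]  AI-written support lemmas for
an AI-planned line; weaker than expert review.
-/

set_option linter.dupNamespace false -- mandated namespace of this single-conjunct summit

open DirectSum

namespace Summit.ResolutionOfSingularities.ResolutionOfSingularities.Theorems.GradedCoarsening

/-! ## Coarsening a grading along an additive map of the degrees -/

section Coarsen

variable {ι κ A : Type*} [DecidableEq ι] [AddCommMonoid ι] [AddCommMonoid κ]
  [CommRing A] (𝒜 : ι → AddSubgroup A) [GradedRing 𝒜] (f : ι →+ κ)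

/-- **The coarsened grading** along `f : ι →+ κ`: `A_k := ⊕_{f i = k} A_i`, i.e. the elements all of whose
`𝒜`-components of degree outside `f⁻¹(k)` vanish. [folklore] -/
def coarsen (k : κ) : AddSubgroup A where
  carrier := {a | ∀ i, f i ≠ k → (decompose 𝒜 a i : A) = 0}
  zero_mem' i _ := by simp
  add_mem' {a b} ha hb i hi := by simp [decompose_add, ha i hi, hb i hi]
  neg_mem' {a} ha i hi := by
    have h : (-(decompose 𝒜 a)) i = -(decompose 𝒜 a i) := rfl
    rw [decompose_neg, h, AddSubgroup.coe_neg, ha i hi, neg_zero]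

variable {𝒜 f} in
/-- Membership in a coarsened piece. [folklore] -/
theorem mem_coarsen_iff {k : κ} {a : A} :
    a ∈ coarsen 𝒜 f k ↔ ∀ i, f i ≠ k → (decompose 𝒜 a i : A) = 0 :=
  Iff.rfl

variable {𝒜 f} in
/-- A homogeneous element of degree `i` is homogeneous of degree `f i` for the coarsened grading. [folklore] -/
theorem mem_coarsen_of_mem {i : ι} {x : A} (hx : x ∈ 𝒜 i) : x ∈ coarsen 𝒜 f (f i) :=
  fun _ hi' => decompose_of_mem_ne 𝒜 hx fun h => hi' (h ▸ rfl)

variable {𝒜 f} in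
/-- Coarsening further: if `f' = g ∘ f` then a piece of the `f`-coarsening lies in a piece of the
`f'`-coarsening. [folklore] -/
theorem mem_coarsen_of_mem_coarsen {κ' : Type*} [AddCommMonoid κ'] {f' : ι →+ κ'}
    {g : κ → κ'} (hg : ∀ i, f' i = g (f i)) {k : κ} {x : A} (hx : x ∈ coarsen 𝒜 f k) :
    x ∈ coarsen 𝒜 f' (g k) :=
  fun i hi => hx i fun h => hi (by rw [hg, h])

variable [DecidableEq κ]

/-- The coarsened pieces form a graded monoid. [folklore] -/
theorem gradedMonoid_coarsen : SetLike.GradedMonoid (coarsen 𝒜 f) where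
  one_mem := by simpa only [map_zero] using mem_coarsen_of_mem (f := f) (SetLike.one_mem_graded 𝒜)
  mul_mem := by
    classical
    intro k l a b ha hb n hn
    rw [decompose_mul, coe_mul_apply]
    refine Finset.sum_eq_zero fun ij hij => ?_
    rw [Finset.mem_filter] at hij
    obtain ⟨-, hsum⟩ := hij
    have hor : f ij.1 ≠ k ∨ f ij.2 ≠ l := by
      by_contra hc
      push Not at hc
      exact hn (by rw [← hsum, map_add, hc.1, hc.2])
    rcases hor with h | h
    · rw [ha _ h, zero_mul]
    · rw [hb _ h, mul_zero]

/-- **The coarsened pieces grade the ring** (`A = ⊕ₖ A_k`, with the decomposition obtained by regrouping the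
`𝒜`-components). [folklore] -/
theorem nonempty_gradedRing_coarsen : Nonempty (GradedRing (coarsen 𝒜 f)) := by
  classical
  have hle : ∀ i, 𝒜 i ≤ coarsen 𝒜 f (f i) := fun i x hx => mem_coarsen_of_mem hx
  let g : (⨁ i, 𝒜 i) →+ ⨁ k, coarsen 𝒜 f k :=
    DirectSum.toAddMonoid fun i =>
      (DirectSum.of (fun k => coarsen 𝒜 f k) (f i)).comp (AddSubgroup.inclusion (hle i))
  have hg : ∀ (i : ι) (x : 𝒜 i), g (DirectSum.of (fun i => 𝒜 i) i x) =
      DirectSum.of (fun k => coarsen 𝒜 f k) (f i) ⟨x, hle i x.2⟩ := by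
    intro i x
    simp only [g, DirectSum.toAddMonoid_of, AddMonoidHom.coe_comp, Function.comp_apply]
    rfl
  let φ : A →+ ⨁ k, coarsen 𝒜 f k :=
    { toFun := fun a => g (decompose 𝒜 a)
      map_zero' := by simp
      map_add' := fun a b => by simp [decompose_add] }
  have hφ : ∀ a, φ a = g (decompose 𝒜 a) := fun _ => rfl
  have hof : ∀ {k k' : κ} (_ : k = k') (x : A) (hx : x ∈ coarsen 𝒜 f k) (hx' : x ∈ coarsen 𝒜 f k'),
      DirectSum.of (fun k => coarsen 𝒜 f k) k ⟨x, hx⟩ = DirectSum.of (fun k => coarsen 𝒜 f k) k' ⟨x, hx'⟩ := by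
    intro k k' h
    subst h
    intro x hx hx'
    rfl
  -- a homogeneous element of the coarsened grading is sent to the corresponding `of`
  have hφ_of : ∀ (k : κ) (y : coarsen 𝒜 f k), φ (y : A) = DirectSum.of (fun k => coarsen 𝒜 f k) k y := by
    intro k y
    have hmem : ∀ i, (decompose 𝒜 (y : A) i : A) ∈ coarsen 𝒜 f k := by
      intro i
      by_cases hi : f i = k
      · intro i' hi'
        exact decompose_of_mem_ne 𝒜 (SetLike.coe_mem (decompose 𝒜 (y : A) i)) fun h => hi' (h ▸ hi)
      · rw [y.2 i hi]
        exact zero_mem _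
    have hterm : ∀ i ∈ (decompose 𝒜 (y : A)).support,
        g (DirectSum.of (fun i => 𝒜 i) i (decompose 𝒜 (y : A) i)) =
          DirectSum.of (fun k => coarsen 𝒜 f k) k ⟨decompose 𝒜 (y : A) i, hmem i⟩ := by
      intro i hi
      have hik : f i = k := by
        by_contra hik
        rw [DFinsupp.mem_support_iff] at hi
        exact hi (Subtype.ext (y.2 i hik))
      rw [hg]
      exact hof hik _ _ _
    rw [hφ, ← sum_support_of (decompose 𝒜 (y : A)), map_sum, Finset.sum_congr rfl hterm, ← map_sum]
    congr 1
    apply Subtype.ext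
    rw [AddSubgroup.val_finsetSum]
    exact sum_support_decompose 𝒜 (y : A)
  have left : (DirectSum.coeAddMonoidHom (coarsen 𝒜 f)).comp φ = AddMonoidHom.id A := by
    have key : (DirectSum.coeAddMonoidHom (coarsen 𝒜 f)).comp g =
        DirectSum.coeAddMonoidHom (fun i => 𝒜 i) := by
      refine DirectSum.addHom_ext fun i x => ?_
      rw [AddMonoidHom.comp_apply, hg, coeAddMonoidHom_of, coeAddMonoidHom_of]
    ext a
    rw [AddMonoidHom.comp_apply, hφ, ← AddMonoidHom.comp_apply, key, AddMonoidHom.id_apply]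
    exact (decompose 𝒜).symm_apply_apply a
  have right : φ.comp (DirectSum.coeAddMonoidHom (coarsen 𝒜 f)) = AddMonoidHom.id _ := by
    refine DirectSum.addHom_ext fun k y => ?_
    rw [AddMonoidHom.comp_apply, coeAddMonoidHom_of, AddMonoidHom.id_apply]
    exact hφ_of k y
  exact ⟨{ (gradedMonoid_coarsen 𝒜 f) with toDecomposition := Decomposition.ofAddHom (coarsen 𝒜 f) φ left right }⟩

variable {𝒜 f} in
/-- A homogeneous ideal is homogeneous for every coarsening (for ANY graded-ring structure on the coarsened
pieces). [folklore] -/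
theorem isHomogeneous_coarsen_of_isHomogeneous [GradedRing (coarsen 𝒜 f)] {I : Ideal A}
    (hI : I.IsHomogeneous 𝒜) : I.IsHomogeneous (coarsen 𝒜 f) := by
  obtain ⟨T, rfl⟩ := (Ideal.IsHomogeneous.iff_exists 𝒜 _).mp hI
  refine Ideal.homogeneous_span _ _ ?_
  rintro _ ⟨t, _, rfl⟩
  obtain ⟨i, hi⟩ := t.2
  exact ⟨f i, mem_coarsen_of_mem hi⟩

variable {𝒜 f} in
/-- An ideal homogeneous for a coarsening is homogeneous for every coarser coarsening (`f' = g ∘ f`; any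
graded-ring structures). [folklore] -/
theorem isHomogeneous_coarsen_of_isHomogeneous_coarsen {κ' : Type*} [DecidableEq κ'] [AddCommMonoid κ']
    {f' : ι →+ κ'} {g : κ → κ'} (hg : ∀ i, f' i = g (f i)) [GradedRing (coarsen 𝒜 f)]
    [GradedRing (coarsen 𝒜 f')] {I : Ideal A} (hI : I.IsHomogeneous (coarsen 𝒜 f)) :
    I.IsHomogeneous (coarsen 𝒜 f') := by
  obtain ⟨T, rfl⟩ := (Ideal.IsHomogeneous.iff_exists (coarsen 𝒜 f) _).mp hI
  refine Ideal.homogeneous_span _ _ ?_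
  rintro _ ⟨t, _, rfl⟩
  obtain ⟨k, hk⟩ := t.2
  exact ⟨g k, mem_coarsen_of_mem_coarsen hg hk⟩

end Coarsen

/-! ## One step: a homogeneous unit `u` of non-zero degree and the ideal `Q + (u - 1)` -/

section Step

variable {ι A : Type*} [DecidableEq ι] [CommRing A]

/-- `u - 1 ∉ Q` for a proper homogeneous ideal `Q` and a homogeneous unit `u` of non-zero degree: the
component of `u - 1` in the degree of `u` is `u`. [folklore] -/
theorem sub_one_not_mem [AddMonoid ι] (𝒜 : ι → AddSubgroup A) [GradedRing 𝒜] {Q : Ideal A}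
    (hQ : Q.IsHomogeneous 𝒜) (hQtop : Q ≠ ⊤) {δ : ι} (hδ : δ ≠ 0) {u : A} (hu : u ∈ 𝒜 δ)
    (hunit : IsUnit u) : u - 1 ∉ Q := by
  intro h
  have h1 := hQ δ h
  rw [decompose_sub, DirectSum.sub_apply, AddSubgroup.coe_sub, decompose_of_mem_same 𝒜 hu,
    decompose_of_mem_ne 𝒜 (SetLike.one_mem_graded 𝒜) (Ne.symm hδ), sub_zero] at h1
  exact hQtop (Ideal.eq_top_of_isUnit_mem Q h1 hunit)

/-- `Q + (u - 1)` is a proper ideal, for a proper homogeneous ideal `Q` (grading by a commutative GROUP `ι`)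
and a homogeneous unit `u` whose degree `δ` is detected by an additive map `φ : ι →+ ℤ` (`φ δ > 0`).
If `a (u - 1) + b = 1` with `b ∈ Q`, every component of `a(u - 1) - 1` lies in `Q`; among the components
`a_χ ∉ Q`, one of least `φ`-value must have `χ = 0` and one of largest `φ`-value must have `χ + δ = 0`,
which is absurd. [folklore] -/
theorem sup_span_sub_one_ne_top [AddCommGroup ι] (𝒜 : ι → AddSubgroup A) [GradedRing 𝒜] (φ : ι →+ ℤ)
    {Q : Ideal A} (hQ : Q.IsHomogeneous 𝒜) (hQtop : Q ≠ ⊤) {δ : ι} (hδ : 0 < φ δ) {u : A}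
    (hu : u ∈ 𝒜 δ) (hunit : IsUnit u) : Q ⊔ Ideal.span {u - 1} ≠ ⊤ := by
  classical
  intro htop
  have h1 : (1 : A) ∈ Ideal.span {u - 1} ⊔ Q := by
    rw [sup_comm, htop]; exact Submodule.mem_top
  obtain ⟨a, b, hb, hab⟩ := Ideal.mem_span_singleton_sup.mp h1
  -- every component of `a (u - 1) - 1` lies in `Q`
  have key : ∀ χ : ι, (decompose 𝒜 a (χ - δ) : A) * u - (decompose 𝒜 a χ : A)
      - (decompose 𝒜 (1 : A) χ : A) ∈ Q := by
    intro χ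
    have hbχ : (decompose 𝒜 b χ : A) ∈ Q := hQ χ hb
    have e1 : (decompose 𝒜 (a * (u - 1)) χ : A) + (decompose 𝒜 b χ : A) =
        (decompose 𝒜 (1 : A) χ : A) := by
      rw [← AddSubgroup.coe_add, ← DirectSum.add_apply, ← decompose_add, hab]
    have e2 : (decompose 𝒜 (a * (u - 1)) χ : A) =
        (decompose 𝒜 a (χ - δ) : A) * u - (decompose 𝒜 a χ : A) := by
      have hmul := coe_decompose_mul_add_of_right_mem 𝒜 (a := a) (i := χ - δ) hu
      rw [sub_add_cancel] at hmul
      rw [mul_sub, mul_one, decompose_sub, DirectSum.sub_apply, AddSubgroup.coe_sub, hmul]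
    have e3 : (decompose 𝒜 a (χ - δ) : A) * u - (decompose 𝒜 a χ : A) - (decompose 𝒜 (1 : A) χ : A)
        = -(decompose 𝒜 b χ : A) := by
      rw [← e2]; linear_combination e1
    rw [e3]
    exact Q.neg_mem hbχ
  -- the components of `a` outside `Q`
  set S : Finset ι := (decompose 𝒜 a).support.filter fun χ => (decompose 𝒜 a χ : A) ∉ Q with hS_def
  have hS : ∀ χ, χ ∉ S → (decompose 𝒜 a χ : A) ∈ Q := by
    intro χ hχ
    by_contra hnot
    apply hχ
    rw [hS_def, Finset.mem_filter, DFinsupp.mem_support_iff]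
    refine ⟨fun h0 => hnot ?_, hnot⟩
    rw [h0, ZeroMemClass.coe_zero]
    exact zero_mem Q
  have hone : ∀ χ : ι, χ ≠ 0 → (decompose 𝒜 (1 : A) χ : A) = 0 :=
    fun χ hχ => decompose_of_mem_ne 𝒜 (SetLike.one_mem_graded 𝒜) (Ne.symm hχ)
  obtain ⟨v, hv⟩ := hunit.exists_right_inv
  by_cases hSne : S.Nonempty
  · obtain ⟨χ₁, hχ₁S, hmin⟩ := S.exists_min_image φ hSne
    obtain ⟨χ₂, hχ₂S, hmax⟩ := S.exists_max_image φ hSne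
    have hχ₁Q : (decompose 𝒜 a χ₁ : A) ∉ Q := (Finset.mem_filter.mp hχ₁S).2
    have hχ₂Q : (decompose 𝒜 a χ₂ : A) ∉ Q := (Finset.mem_filter.mp hχ₂S).2
    -- the lowest component outside `Q` sits in degree `0`
    have hlow : χ₁ = 0 := by
      by_contra hne0
      have hout : χ₁ - δ ∉ S := by
        intro hin
        have := hmin _ hin
        rw [map_sub] at this
        omega
      have k := key χ₁
      rw [hone χ₁ hne0, sub_zero] at k
      apply hχ₁Q
      have := Q.sub_mem (Q.mul_mem_right u (hS _ hout)) k
      simpa using this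
    -- the highest component outside `Q` sits in degree `-δ`
    have hup : χ₂ + δ = 0 := by
      by_contra hne0
      have hout : χ₂ + δ ∉ S := by
        intro hin
        have := hmax _ hin
        rw [map_add] at this
        omega
      have k := key (χ₂ + δ)
      rw [add_sub_cancel_right, hone _ hne0, sub_zero] at k
      apply hχ₂Q
      have h3 : (decompose 𝒜 a χ₂ : A) * u ∈ Q := by
        have := Q.add_mem k (hS _ hout)
        simpa using this
      have h4 := Q.mul_mem_right v h3
      rwa [mul_assoc, hv, mul_one] at h4
    have h12 : φ χ₁ ≤ φ χ₂ := hmin χ₂ hχ₂S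
    have h2 : φ χ₂ + φ δ = 0 := by rw [← map_add, hup, map_zero]
    rw [hlow, map_zero] at h12
    omega
  · -- every component of `a` lies in `Q`: then `1 ∈ Q`
    rw [Finset.not_nonempty_iff_eq_empty] at hSne
    have hall : ∀ χ, (decompose 𝒜 a χ : A) ∈ Q := fun χ => hS χ (by simp [hSne])
    have k := key 0
    rw [zero_sub, decompose_of_mem_same 𝒜 (SetLike.one_mem_graded 𝒜)] at k
    apply hQtop
    rw [Ideal.eq_top_iff_one]
    have := Q.sub_mem (Q.sub_mem (Q.mul_mem_right u (hall (-δ))) (hall 0)) k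
    simpa using this

end Step

end Summit.ResolutionOfSingularities.ResolutionOfSingularities.Theorems.GradedCoarsening
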